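import Summits.Langlands.Langlands.Theses.PhantomRMYoshida
import Summits.Langlands.Langlands.Theses.AnalyticDescent
import Summits.Langlands.Langlands.Theorems.IrreducibilityBySelfDualityIrreducibleOffSectorOfReciprocity
import Literature.NumberTheory.Automorphic.ChebotarevArtinRepHolds
import Literature.NumberTheory.GaloisRepresentations.FramedRepEquivConj
import HarnessLib

/-!
# `PhantomRMYoshida.PhantomRMJunction` is sandwiched by the item `ReciprocityUpToIrreducibilityR`
(stmt-Langlands-17925) granted Arthur–Clozel (2.2)–(2.3) — item-level certificate
(crux stmt-Langlands-13643, line `PhantomRMJunctionOfPieces`, lead prover-line-stmt-Langlands-13643-c17-0;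
`--supports` file: no sorry, no new definition, axioms `propext`/`Classical.choice`/`Quot.sound`)

`PhantomRMJunction := ∀ _ : PhantomRMSector, _root_.Langlands` is the D-0027 frame item of route
`PhantomRMYoshida` (the rest of `GL_n` reciprocity; its sector hypothesis is idle:
`Theorems/PhantomRMYoshidaPhantomRMJunction.lean`, `not_phantomRMJunction_iff`).  This file records, on the
texts of EXISTING items, where the junction's open content actually lives after the 2026-08-17 re-type of
the summit (`∀ F, Nonempty (ReciprocityData F) ∧ ∀ 𝓡 n hcpt, (A) ∧ (B)`):

* R  := the text of item stmt-Langlands-17925 `IrreducibilityBySelfDuality.ReciprocityUpToIrreducibilityR`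
  (reciprocity up to irreducibility for EVERY pinned reciprocity datum, with the non-vacuity conjunct:
  the summit minus irreducibility and uniqueness-up-to-conjugacy in clause (A); written out verbatim because
  the decl lives in another route's Theses module);
* JS := items stmt-Langlands-13622 `PairLBoundaryJS` (Arthur–Clozel Ch. 3 (2.2)) and stmt-Langlands-19093
  `PairLPoleJS` ((2.3)), cited by name through `Theses/AnalyticDescent.lean` (both are decls of that item).

Theorems:
* `langlands_of_reciprocityUpToIrreducibilityR_text_of_JS` — JS (2.2) → JS (2.3) → R → `Langlands`: for
  each `𝓡`, clause (B) is R's; the avatar of clause (A) — and every a.e.-compatible `ρ'` — is irreducible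
  by the landed isobaric bootstrap `IrreducibleOffSector.isIrreducible_of_reciprocityUpToIrreducibility`
  (p103935), hence semisimple; two corresponding avatars have equal Satake parameters a.e.
  (`hasSatakeParamAt_unique_holds`), so equal Frobenius polynomials a.e., so are equivalent (Chebotarev +
  Brauer–Nesbitt, `FramedGaloisRep.nonempty_equiv_of_hasFrobCharpolyAt_eventually`), so conjugate
  (`FramedRep.exists_eq_conj_of_equiv`).  This RE-ELABORATES, on the item texts used here, the landed seam
  `SectorComplementSeam.langlands_of_reciprocityUpToIrreducibility_forall_text_of_JS` (p147356,
  `Theorems/EisensteinGelfandKirillovSectorComplementSeam.lean`), whose module the farm still serves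
  unbuilt at the time of writing — switch to the import when it is built;
* `phantomRMJunction_of_reciprocityUpToIrreducibilityR_text_of_JS` — SUFFICIENCY: JS ∧ R ⇒ the crux;
* `reciprocityUpToIrreducibilityR_text_of_langlands` — R is a weakening of the summit (unconditional);
* `reciprocityUpToIrreducibilityR_text_of_junction` — NECESSITY under the route target: `PhantomRMSector`
  and the crux give R (the crux cannot close before stmt-Langlands-17925 once the target holds);
* `phantomRMJunction_iff_reciprocityUpToIrreducibilityR_text` — under JS and the target, crux ↔ R.

References: K. Buzzard, T. Gee, LMS LNS 414 (2014), Conj. 3.2.1–3.2.2 [BuzzardGeeLMS2014]; J.-M. Fontaine,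
B. Mazur (1995), Conj. 1 [FontaineMazurGeometric1995]; J. Arthur, L. Clozel, Ann. Math. Stud. 120, Ch. 3 §2
(2.2)–(2.3) [ArthurClozelAMS120]; F. Calegari, T. Gee, Ann. Inst. Fourier 63 (2013) §1.1 [CalegariGee2013];
P. Deligne, J.-P. Serre, ASENS 7 (1974), Lemme 3.2 [DeligneSerreASENS1974].
-/

noncomputable section

set_option linter.dupNamespace false -- project-wide option; `Summit.Langlands.Langlands` is the mandated namespace

open scoped NumberField
open Filter IsDedekindDomain
open Literature.NumberTheory.Automorphic Literature.NumberTheory.GaloisRepresentations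
open Summit.Langlands
open Summit.Langlands.Langlands.Theses
open Summit.Langlands.Langlands.Theorems.IrreducibleOffSector

namespace Summit.Langlands.Langlands.Theorems.PhantomRMYoshidaJunctionOfR

/-- **`Langlands` (re-typed, `∀ 𝓡`) from the text R of item stmt-Langlands-17925 and Arthur–Clozel
(2.2)–(2.3) for Borel–Jacquet data** (items stmt-Langlands-13622 / stmt-Langlands-19093, by name).  For
each `𝓡`: clause (B) is R's; clause (A)'s avatar — and every a.e.-compatible `ρ'` — is irreducible by the
isobaric bootstrap, hence semisimple, and two corresponding avatars have equal Satake parameters a.e., so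
equal Frobenius polynomials a.e., so are equivalent (Chebotarev + Brauer–Nesbitt), so conjugate.
Re-elaborates the landed seam `SectorComplementSeam.langlands_of_reciprocityUpToIrreducibility_forall_text_of_JS`
(p147356) on these texts. [cite: CalegariGee2013, §1.1] [cite: BuzzardGeeLMS2014, Conj. 3.2.1 and Conj. 3.2.2]
[cite: DeligneSerreASENS1974, Lemme 3.2] -/
theorem langlands_of_reciprocityUpToIrreducibilityR_text_of_JS
    (h22 : AnalyticDescent.PairLBoundaryJS) (h23 : AnalyticDescent.PairLPoleJS)
    (hR : ∀ (F : Type) [Field F] [NumberField F], Nonempty (ReciprocityData F) ∧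
      ∀ (Rec : ReciprocityData F) (n : ℕ), 0 < n →
        ∀ hcpt : Literature.NumberTheory.Automorphic.isCompact_glFiniteIntegralLevel n F,
          (∀ π : Literature.NumberTheory.Automorphic.CuspidalAutomorphicRepData n F hcpt, π.1.IsLAlgebraic →
            ∀ (ℓ : ℕ) [Fact ℓ.Prime] (ι : PadicAlgCl ℓ ≃+* ℂ),
              ∃ ρ : Literature.NumberTheory.GaloisRepresentations.FramedGaloisRep F (PadicAlgCl ℓ) n,
                IsGeometricFramed Rec ρ ∧ Corresponds Rec ι π.1 ρ) ∧ GaloisToAutomorphic n Rec hcpt) :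
    _root_.Langlands := by
  intro F _ _
  refine ⟨(hR F).1, fun Rec n hn hcpt => ?_⟩
  have hRec := fun n hn hcpt => (hR F).2 Rec n hn hcpt
  obtain ⟨hA, hB⟩ := (hR F).2 Rec n hn hcpt
  refine ⟨?_, hB⟩
  intro π hL ℓ _ ι
  -- irreducibility of EVERY avatar Satake–Frobenius compatible a.e. with `π`: the isobaric bootstrap
  have irr : ∀ ρ : FramedGaloisRep F (PadicAlgCl ℓ) n,
      (∀ᶠ v : HeightOneSpectrum (𝓞 F) in cofinite, SatakeFrobCompatibleAt ι π.1 ρ v) →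
        ρ.toGaloisRep.IsIrreducible :=
    fun ρ hρ => isIrreducible_of_reciprocityUpToIrreducibility h22 h23 hRec hcpt hn π hL ι ρ hρ
  obtain ⟨ρ, hgeo, hcorr⟩ := hA π hL ℓ ι
  refine ⟨ρ, irr ρ hcorr.1, hgeo, hcorr, fun ρ' hcorr' => ?_⟩
  -- uniqueness up to conjugacy: irreducible ⇒ semisimple; equal Satake parameters a.e. (Flath)
  -- ⇒ equal Frobenius polynomials a.e. ⇒ equivalent (Chebotarev + Brauer–Nesbitt) ⇒ conjugate
  have h1 : ρ.toGaloisRep.IsIrreducible := irr ρ hcorr.1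
  have h2 : ρ'.toGaloisRep.IsIrreducible := irr ρ' hcorr'.1
  have hs1 : ρ.toGaloisRep.IsSemisimple := by
    haveI := h1
    change ComplementedLattice _
    infer_instance
  have hs2 : ρ'.toGaloisRep.IsSemisimple := by
    haveI := h2
    change ComplementedLattice _
    infer_instance
  have hev : ∀ᶠ v : HeightOneSpectrum (𝓞 F) in cofinite,
      ρ.IsUnramifiedAt v ∧ ρ'.IsUnramifiedAt v ∧
        ∃ P : Polynomial (PadicAlgCl ℓ), ρ.HasFrobCharpolyAt v P ∧ ρ'.HasFrobCharpolyAt v P := by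
    filter_upwards [hcorr.1, hcorr'.1] with v hv hv'
    obtain ⟨α, hα, hur, hcp⟩ := hv
    obtain ⟨α', hα', hur', hcp'⟩ := hv'
    obtain rfl : α = α' := AutomorphicRepData.hasSatakeParamAt_unique_holds π.1 hα hα'
    exact ⟨hur, hur', _, hcp, hcp'⟩
  obtain ⟨e⟩ := FramedGaloisRep.nonempty_equiv_of_hasFrobCharpolyAt_eventually
    chebotarev_artinRep_holds ρ ρ' hs1 hs2 hev
  obtain ⟨P, hP⟩ := FramedRep.exists_eq_conj_of_equiv ρ ρ' e
  exact ⟨P, hP.symm⟩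

/-- **SUFFICIENCY — the crux from R and JS (2.2)–(2.3)**: `PhantomRMYoshida.PhantomRMJunction` follows from
the texts of items stmt-Langlands-17925, stmt-Langlands-13622, stmt-Langlands-19093 (the sector hypothesis is
discarded). [cite: BuzzardGeeLMS2014, Conj. 3.2.1 and Conj. 3.2.2] [cite: ArthurClozelAMS120, Ch. 3 §2 (2.2)–(2.3)] -/
theorem phantomRMJunction_of_reciprocityUpToIrreducibilityR_text_of_JS
    (h22 : AnalyticDescent.PairLBoundaryJS) (h23 : AnalyticDescent.PairLPoleJS)
    (hR : ∀ (F : Type) [Field F] [NumberField F], Nonempty (ReciprocityData F) ∧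
      ∀ (Rec : ReciprocityData F) (n : ℕ), 0 < n →
        ∀ hcpt : Literature.NumberTheory.Automorphic.isCompact_glFiniteIntegralLevel n F,
          (∀ π : Literature.NumberTheory.Automorphic.CuspidalAutomorphicRepData n F hcpt, π.1.IsLAlgebraic →
            ∀ (ℓ : ℕ) [Fact ℓ.Prime] (ι : PadicAlgCl ℓ ≃+* ℂ),
              ∃ ρ : Literature.NumberTheory.GaloisRepresentations.FramedGaloisRep F (PadicAlgCl ℓ) n,
                IsGeometricFramed Rec ρ ∧ Corresponds Rec ι π.1 ρ) ∧ GaloisToAutomorphic n Rec hcpt) :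
    PhantomRMYoshida.PhantomRMJunction := by
  unfold PhantomRMYoshida.PhantomRMJunction
  intro _
  exact langlands_of_reciprocityUpToIrreducibilityR_text_of_JS h22 h23 hR

/-- **R is a weakening of the summit** (drop irreducibility and uniqueness-up-to-conjugacy in clause (A)):
`Langlands` implies the text of item stmt-Langlands-17925, unconditionally. [folklore] -/
theorem reciprocityUpToIrreducibilityR_text_of_langlands : _root_.Langlands → ∀ (F : Type) [Field F] [NumberField F], Nonempty (Summit.Langlands.ReciprocityData F) ∧ ∀ (Rec : Summit.Langlands.ReciprocityData F) (n : ℕ), 0 < n → ∀ hcpt : Literature.NumberTheory.Automorphic.isCompact_glFiniteIntegralLevel n F, (∀ π : Literature.NumberTheory.Automorphic.CuspidalAutomorphicRepData n F hcpt, π.1.IsLAlgebraic → ∀ (ℓ : ℕ) [Fact ℓ.Prime] (ι : PadicAlgCl ℓ ≃+* ℂ), ∃ ρ : Literature.NumberTheory.GaloisRepresentations.FramedGaloisRep F (PadicAlgCl ℓ) n, Summit.Langlands.IsGeometricFramed Rec ρ ∧ Summit.Langlands.Corresponds Rec ι π.1 ρ) ∧ Summit.Langlands.GaloisToAutomorphic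 n Rec hcpt := by
  intro hL F _ _
  refine ⟨(hL F).1, fun Rec n hn hcpt ↦ ?_⟩
  obtain ⟨hA, hB⟩ := (hL F).2 Rec n hn hcpt
  refine ⟨fun π hπ ℓ _ ι ↦ ?_, hB⟩
  obtain ⟨ρ, -, hgeo, hcorr, -⟩ := hA π hπ ℓ ι
  exact ⟨ρ, hgeo, hcorr⟩

/-- **NECESSITY under the route target**: granted `PhantomRMSector` (the conjunction of the route's three
content cruxes, `Theorems/PhantomRMYoshidaSectorGlue.lean`), the crux `PhantomRMJunction` yields the summit and
hence the text of item stmt-Langlands-17925 — the crux cannot close before that item once the target holds.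
[folklore] -/
theorem reciprocityUpToIrreducibilityR_text_of_junction (hX : PhantomRMYoshida.PhantomRMSector)
    (hJ : PhantomRMYoshida.PhantomRMJunction) :
    ∀ (F : Type) [Field F] [NumberField F], Nonempty (ReciprocityData F) ∧
      ∀ (Rec : ReciprocityData F) (n : ℕ), 0 < n →
        ∀ hcpt : Literature.NumberTheory.Automorphic.isCompact_glFiniteIntegralLevel n F,
          (∀ π : Literature.NumberTheory.Automorphic.CuspidalAutomorphicRepData n F hcpt, π.1.IsLAlgebraic →
            ∀ (ℓ : ℕ) [Fact ℓ.Prime] (ι : PadicAlgCl ℓ ≃+* ℂ),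
              ∃ ρ : Literature.NumberTheory.GaloisRepresentations.FramedGaloisRep F (PadicAlgCl ℓ) n,
                IsGeometricFramed Rec ρ ∧ Corresponds Rec ι π.1 ρ) ∧ GaloisToAutomorphic n Rec hcpt :=
  reciprocityUpToIrreducibilityR_text_of_langlands (hJ hX)

/-- **Under JS (2.2)–(2.3) and the route target, the crux is EQUIVALENT to the text of item
stmt-Langlands-17925** (sufficiency + necessity above): the junction's open content is exactly reciprocity up
to irreducibility for every pinned reciprocity datum.
[cite: BuzzardGeeLMS2014, Conj. 3.2.1 and Conj. 3.2.2] [cite: ArthurClozelAMS120, Ch. 3 §2 (2.2)–(2.3)] -/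
theorem phantomRMJunction_iff_reciprocityUpToIrreducibilityR_text
    (h22 : AnalyticDescent.PairLBoundaryJS) (h23 : AnalyticDescent.PairLPoleJS)
    (hX : PhantomRMYoshida.PhantomRMSector) :
    PhantomRMYoshida.PhantomRMJunction ↔
      ∀ (F : Type) [Field F] [NumberField F], Nonempty (ReciprocityData F) ∧
        ∀ (Rec : ReciprocityData F) (n : ℕ), 0 < n →
          ∀ hcpt : Literature.NumberTheory.Automorphic.isCompact_glFiniteIntegralLevel n F,
            (∀ π : Literature.NumberTheory.Automorphic.CuspidalAutomorphicRepData n F hcpt, π.1.IsLAlgebraic →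
              ∀ (ℓ : ℕ) [Fact ℓ.Prime] (ι : PadicAlgCl ℓ ≃+* ℂ),
                ∃ ρ : Literature.NumberTheory.GaloisRepresentations.FramedGaloisRep F (PadicAlgCl ℓ) n,
                  IsGeometricFramed Rec ρ ∧ Corresponds Rec ι π.1 ρ) ∧ GaloisToAutomorphic n Rec hcpt :=
  ⟨reciprocityUpToIrreducibilityR_text_of_junction hX,
    phantomRMJunction_of_reciprocityUpToIrreducibilityR_text_of_JS h22 h23⟩

end Summit.Langlands.Langlands.Theorems.PhantomRMYoshidaJunctionOfR

end
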